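import Mathlib
import Literature.NumberTheory.LFunctions.RiemannXi
import Literature.NumberTheory.LFunctions.RiemannXiProofs
import Literature.NumberTheory.LFunctions.RiemannXiLogDeriv
import Literature.NumberTheory.LFunctions.SuzukiSingleOperatorKernelProofs
import Summits.RiemannHypothesis.RiemannHypothesis.Theorems.DeBrangesSuzukiDoorDefs
import Summits.RiemannHypothesis.RiemannHypothesis.Theorems.DeBrangesSuzukiDoorLaplaceWindow

/-!
# SuzukiWeightedDoor — the shifted door `ShiftedDoor` (RH-FREE implication), PROVED (module 5/6)

For every `θ > 10` and `η ≥ 0`: if `e^{−ηx} W_θ(x) ∈ L²(ℝ)` then `ξ(s) ≠ 0` for `Re s > 1/2 + η`.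
* H1_η `quotient_of_weightedWitness`: `G(z) = 𝓛[e^{−η·}W_θ](z − iη)` is holomorphic on `Im z > η`
  (`differentiableOn_laplace_of_memLp`), `F = unitLaplace` (`F(i(η+1)) ≠ 0`), and `Θ_θ F = G` on `Im z > η + 1`
  (`laplace_window_eq` with the unconditional growth `|K_θ| ≪ e^{3x/4}` and `Suzuki2020_thm12_laplace`).
* H2_η `xi_ne_zero_of_symbolQuotientOn`: the symbol rigidity of `DeBrangesSuzukiDoorSymbolRigidity.lean` run verbatim on
  `U = {Im z > η}`: a zero `s₀` of `ξ` with `Re s₀ > 1/2 + η` is an essential singularity `z₀ = i(s₀ − 1/2) ∈ U` of `Θ_θ`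
  against the meromorphic `G/F`.
An implication between RH-free quantities; nothing here bears on the truth of RH.
-/

noncomputable section

set_option linter.dupNamespace false

open MeasureTheory Complex
open Filter Topology

namespace Summit.RiemannHypothesis.RiemannHypothesis.Theorems.SuzukiWeightedDoorDoor

open Literature.NumberTheory.LFunctions (riemannXi differentiable_riemannXi riemannXi_ne_zero_of_one_le_re
  Suzuki2020_thm12_continuous Suzuki2020_thm12_Kiii Suzuki2020_thm12_laplace abs_limKernel_le)
open Summit.RiemannHypothesis.RiemannHypothesis.Theorems.SuzukiDoor

/-- `f(z) = ξ(1/2 - i z)` (entire). -/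
private noncomputable def xiRot (z : ℂ) : ℂ := riemannXi (1 / 2 - I * z)

/-- `f'(z) = -i ξ'(1/2 - iz)`. -/
private theorem hasDerivAt_xiRot (z : ℂ) :
    HasDerivAt xiRot (-I * deriv riemannXi (1 / 2 - I * z)) z := by
  have h1 : HasDerivAt (fun w : ℂ => 1 / 2 - I * w) (-I) z := by
    simpa using ((hasDerivAt_id z).const_mul I).const_sub (1 / 2 : ℂ)
  have h2 : HasDerivAt riemannXi (deriv riemannXi (1 / 2 - I * z)) (1 / 2 - I * z) :=
    (differentiable_riemannXi _).hasDerivAt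
  have h : HasDerivAt xiRot (deriv riemannXi (1 / 2 - I * z) * -I) z := h2.comp z h1
  convert h using 1
  ring

/-- `f` is entire. -/
private theorem differentiable_xiRot : Differentiable ℂ xiRot :=
  fun z => (hasDerivAt_xiRot z).differentiableAt

/-- `Θ_θ = exp(c · f'/f)` with `c = -2θ i`. -/
private theorem limTheta_eq_exp (θ : ℝ) (z : ℂ) :
    limTheta θ z = Complex.exp ((-2 * θ * I) * (deriv xiRot z / xiRot z)) := by
  unfold limTheta
  congr 1
  rw [(hasDerivAt_xiRot z).deriv]
  show -2 * (θ : ℂ) * (deriv riemannXi (1 / 2 - I * z) / riemannXi (1 / 2 - I * z)) =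
    (-2 * θ * I) * (-I * deriv riemannXi (1 / 2 - I * z) / riemannXi (1 / 2 - I * z))
  have hI : I * I = -1 := I_mul_I
  rw [mul_div_assoc]
  linear_combination (-2 * (θ : ℂ) * (deriv riemannXi (1 / 2 - I * z) / riemannXi (1 / 2 - I * z))) * hI

/-- Derivative of a local factorisation `H = (z - z₀)^n • H₁` near `z₀`. -/
private theorem deriv_of_eventuallyEq_pow_smul {H H₁ : ℂ → ℂ} {z₀ : ℂ} {n : ℕ}
    (hH₁ : AnalyticAt ℂ H₁ z₀) (hev : ∀ᶠ z in 𝓝 z₀, H z = (z - z₀) ^ n • H₁ z) :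
    ∀ᶠ z in 𝓝 z₀, deriv H z = n * (z - z₀) ^ (n - 1) * H₁ z + (z - z₀) ^ n * deriv H₁ z := by
  have hev' : ∀ᶠ z in 𝓝 z₀, H =ᶠ[𝓝 z] fun w => (w - z₀) ^ n * H₁ w := by
    filter_upwards [hev.eventually_nhds] with z hz
    filter_upwards [hz] with w hw
    simpa [smul_eq_mul] using hw
  filter_upwards [hev', hH₁.eventually_analyticAt] with z hz hH₁z
  rw [hz.deriv_eq]
  have h1 : HasDerivAt (fun w : ℂ => (w - z₀) ^ n) (n * (z - z₀) ^ (n - 1)) z := by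
    have h := (hasDerivAt_pow n (z - z₀)).comp z ((hasDerivAt_id' z).sub_const z₀)
    simpa [Function.comp_def, mul_one] using h
  exact (h1.mul hH₁z.differentiableAt.hasDerivAt).deriv

/-- `n w^{n-1} w² = n w^{n+1}` (also for `n = 0`). -/
private theorem natCast_mul_pow_pred_mul_sq (n : ℕ) (w : ℂ) :
    (n : ℂ) * w ^ (n - 1) * w ^ 2 = n * w ^ (n + 1) := by
  cases n with
  | zero => simp
  | succ n => simp [pow_succ]; ring

/-- **H2_η: symbol rigidity on the half-plane `Im z > η` (RH-FREE theorem).** A holomorphic quotient representation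
`Θ_θ · F = G` on `Im z > a` (`a ≥ 1/2`, `a ≥ η ≥ 0`) with `G, F` holomorphic on `Im z > η`, `F ≢ 0` there, forces
`ξ(s) ≠ 0` for `Re s > 1/2 + η` (`θ ≠ 0`). -/
theorem xi_ne_zero_of_symbolQuotientOn {θ a η : ℝ} (hθ : θ ≠ 0) (ha : 1 / 2 ≤ a) (hηa : η ≤ a)
    {G F : ℂ → ℂ}
    (hG : DifferentiableOn ℂ G {z : ℂ | η < z.im}) (hF : DifferentiableOn ℂ F {z : ℂ | η < z.im})
    (hF0 : ∃ z : ℂ, η < z.im ∧ F z ≠ 0) (hGF : ∀ z : ℂ, a < z.im → limTheta θ z * F z = G z) :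
    ∀ s : ℂ, 1 / 2 + η < s.re → riemannXi s ≠ 0 := by
  intro s₀ hs₀ hξ
  obtain ⟨z₁, hz₁, hFz₁⟩ := hF0
  -- Step 0: the zero `z₀ = i(s₀ − 1/2)` of `f` with `Im z₀ > η`.
  obtain ⟨z₀, hz₀, hfz₀⟩ : ∃ z₀ : ℂ, η < z₀.im ∧ xiRot z₀ = 0 := by
    have hI : I * I = -1 := I_mul_I
    refine ⟨I * (s₀ - 1 / 2), ?_, ?_⟩
    · have : (I * (s₀ - 1 / 2)).im = s₀.re - 1 / 2 := by simp
      rw [this]; linarith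
    · show riemannXi (1 / 2 - I * (I * (s₀ - 1 / 2))) = 0
      have : (1 / 2 : ℂ) - I * (I * (s₀ - 1 / 2)) = s₀ := by
        linear_combination (-(s₀ - 1 / 2)) * hI
      rw [this, hξ]
  -- Step 1: set-up on `U = ℂ₊`.
  set c : ℂ := -2 * θ * I with hc
  have hc0 : c ≠ 0 := by
    simp only [hc, ne_eq, mul_eq_zero, I_ne_zero, Complex.ofReal_eq_zero, hθ, neg_eq_zero,
      OfNat.ofNat_ne_zero, or_self, not_false_eq_true]
  set U : Set ℂ := {z | η < z.im} with hU
  have hUo : IsOpen U := isOpen_lt continuous_const Complex.continuous_im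
  have hUc : IsPreconnected U := (convex_halfSpace_im_gt η).isPreconnected
  set zI : ℂ := ((a + 1 : ℝ) : ℂ) * I with hzI
  have hzIim : zI.im = a + 1 := by simp [hzI]
  have hIU : zI ∈ U := by show η < zI.im; rw [hzIim]; linarith
  have hVo : IsOpen {w : ℂ | a < w.im} := isOpen_lt continuous_const Complex.continuous_im
  have hIV : zI ∈ {w : ℂ | a < w.im} := by
    show a < zI.im
    rw [hzIim]; linarith
  have hGa : AnalyticOnNhd ℂ G U := hG.analyticOnNhd hUo
  have hFa : AnalyticOnNhd ℂ F U := hF.analyticOnNhd hUo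
  have hfa : AnalyticOnNhd ℂ xiRot U := differentiable_xiRot.differentiableOn.analyticOnNhd hUo
  set u : ℂ → ℂ := fun z => deriv xiRot z / xiRot z with hu
  have hΘ : ∀ z, limTheta θ z = Complex.exp (c * u z) := fun z => limTheta_eq_exp θ z
  have hfV : ∀ z : ℂ, a < z.im → xiRot z ≠ 0 := by
    intro z hz
    show riemannXi (1 / 2 - I * z) ≠ 0
    exact riemannXi_ne_zero_of_one_le_re (by simp; linarith)
  -- Step 2: the global identity `P = Q` on `U`.
  set P : ℂ → ℂ := fun z => (deriv G z * F z - G z * deriv F z) * xiRot z ^ 2 with hP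
  set Q : ℂ → ℂ := fun z =>
    c * ((deriv (deriv xiRot) z * xiRot z - deriv xiRot z ^ 2) * G z * F z) with hQdef
  have hPa : AnalyticOnNhd ℂ P U :=
    ((hGa.deriv.mul hFa).sub (hGa.mul hFa.deriv)).mul (hfa.pow 2)
  have hQa : AnalyticOnNhd ℂ Q U :=
    analyticOnNhd_const.mul ((((hfa.deriv.deriv.mul hfa).sub (hfa.deriv.pow 2)).mul hGa).mul hFa)
  have hPQV : ∀ z : ℂ, a < z.im → P z = Q z := by
    intro z hz
    have hfz : xiRot z ≠ 0 := hfV z hz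
    have hz0 : z ∈ U := by show η < z.im; linarith
    have hGev : G =ᶠ[𝓝 z] fun w => Complex.exp (c * u w) * F w := by
      filter_upwards [hVo.mem_nhds hz] with w hw
      rw [← hΘ]; exact (hGF w hw).symm
    have hf_an : AnalyticAt ℂ xiRot z := hfa z hz0
    have hdf : HasDerivAt xiRot (deriv xiRot z) z := hf_an.differentiableAt.hasDerivAt
    have hddf : HasDerivAt (deriv xiRot) (deriv (deriv xiRot) z) z :=
      hf_an.deriv.differentiableAt.hasDerivAt
    have hu' : HasDerivAt u
        ((deriv (deriv xiRot) z * xiRot z - deriv xiRot z * deriv xiRot z) / xiRot z ^ 2) z :=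
      hddf.div hdf hfz
    have hdF : HasDerivAt F (deriv F z) z := (hFa z hz0).differentiableAt.hasDerivAt
    have hprod := ((hu'.const_mul c).cexp).mul hdF
    have hderivG : deriv G z = Complex.exp (c * u z) *
        (c * ((deriv (deriv xiRot) z * xiRot z - deriv xiRot z * deriv xiRot z) / xiRot z ^ 2)) *
        F z + Complex.exp (c * u z) * deriv F z := by
      rw [hGev.deriv_eq]; exact hprod.deriv
    have hGz : G z = Complex.exp (c * u z) * F z := hGev.self_of_nhds
    simp only [hP, hQdef]
    rw [hderivG, hGz]
    field_simp
    ring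
  have hPQ : Set.EqOn P Q U := by
    have hev : P =ᶠ[𝓝 zI] Q := by
      filter_upwards [hVo.mem_nhds hIV] with w hw
      exact hPQV w hw
    exact hPa.eqOn_of_preconnected_of_eventuallyEq hQa hUc hIU hev
  -- Step 3: local factorisations at `z₀`.
  have hf_ne : ¬ (∀ᶠ z in 𝓝 z₀, xiRot z = 0) := by
    intro hev
    have h0 := hfa.eqOn_zero_of_preconnected_of_eventuallyEq_zero hUc hz₀ hev
    exact hfV zI hIV (h0 hIU)
  obtain ⟨m, f₁, hf₁a, hf₁0, hfev⟩ := (hfa z₀ hz₀).exists_eventuallyEq_pow_smul_nonzero_iff.2 hf_ne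
  have hm : m ≠ 0 := by
    intro h
    have h1 := hfev.self_of_nhds
    rw [h, pow_zero, one_smul, hfz₀] at h1
    exact hf₁0 h1.symm
  obtain ⟨m', rfl⟩ : ∃ m' : ℕ, m = m' + 1 := ⟨m - 1, by omega⟩
  have hF_ne : ¬ (∀ᶠ z in 𝓝 z₀, F z = 0) := by
    intro hev
    have h0 := hFa.eqOn_zero_of_preconnected_of_eventuallyEq_zero hUc hz₀ hev
    exact hFz₁ (h0 hz₁)
  obtain ⟨k, F₁, hF₁a, hF₁0, hFev⟩ := (hFa z₀ hz₀).exists_eventuallyEq_pow_smul_nonzero_iff.2 hF_ne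
  have hG_ne : ¬ (∀ᶠ z in 𝓝 z₀, G z = 0) := by
    intro hev
    have h0 := hGa.eqOn_zero_of_preconnected_of_eventuallyEq_zero hUc hz₀ hev
    have hFevI : ∀ᶠ w in 𝓝 zI, F w = 0 := by
      filter_upwards [hVo.mem_nhds hIV] with w hw
      have h1 := hGF w hw
      have hw' : a < w.im := hw
      have hGw : G w = 0 := h0 (show η < w.im by linarith)
      rw [hGw, hΘ] at h1
      rcases mul_eq_zero.1 h1 with h | h
      · exact absurd h (Complex.exp_ne_zero _)
      · exact h
    have h00 := hFa.eqOn_zero_of_preconnected_of_eventuallyEq_zero hUc hIU hFevI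
    exact hFz₁ (h00 hz₁)
  obtain ⟨j, G₁, hG₁a, hG₁0, hGev⟩ := (hGa z₀ hz₀).exists_eventuallyEq_pow_smul_nonzero_iff.2 hG_ne
  -- derivative forms near `z₀`
  have hdf_ev := deriv_of_eventuallyEq_pow_smul hf₁a hfev
  have hdF_ev := deriv_of_eventuallyEq_pow_smul hF₁a hFev
  have hdG_ev := deriv_of_eventuallyEq_pow_smul hG₁a hGev
  have hf₁ne : ∀ᶠ z in 𝓝 z₀, f₁ z ≠ 0 := hf₁a.continuousAt.eventually_ne hf₁0
  -- the holomorphic part `v` of `u' = (f'/f)'` at `z₀`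
  set v : ℂ → ℂ := fun z => deriv (fun w => deriv f₁ w / f₁ w) z with hv
  have hq_an : AnalyticAt ℂ (fun w => deriv f₁ w / f₁ w) z₀ := hf₁a.deriv.div hf₁a hf₁0
  have hv_cont : ContinuousAt v z₀ := hq_an.deriv.continuousAt
  -- Step 4: on a punctured neighbourhood, `(z - z₀) · A z = c · B z`.
  set A : ℂ → ℂ := fun z => ((j : ℂ) - k) * G₁ z * F₁ z +
    (z - z₀) * (deriv G₁ z * F₁ z - G₁ z * deriv F₁ z) with hA
  set B : ℂ → ℂ := fun z => (-(m' + 1 : ℕ) + (z - z₀) ^ 2 * v z) * G₁ z * F₁ z with hB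
  have hloc : ∀ᶠ z in 𝓝[≠] z₀, (z - z₀) * A z = c * B z := by
    -- gather everything valid near z₀, plus `z ≠ z₀`
    have hU_ev : ∀ᶠ z in 𝓝 z₀, z ∈ U := hUo.mem_nhds hz₀
    have hf₁an_ev := hf₁a.eventually_analyticAt
    have hfev2 := hfev.eventually_nhds
    have hdfev2 := hdf_ev.eventually_nhds
    have hf₁ne2 := hf₁ne.eventually_nhds
    have hall : ∀ᶠ z in 𝓝 z₀, z ≠ z₀ → (z - z₀) * A z = c * B z := by
      filter_upwards [hU_ev, hfev, hdf_ev, hFev, hdF_ev, hGev, hdG_ev, hf₁ne, hf₁an_ev, hfev2, hdfev2,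
        hf₁ne2] with z hzU hfz hdfz hFz hdFz hGz hdGz hf₁z hf₁an hfz2 hdfz2 hf₁ne2z hne
      have hw : z - z₀ ≠ 0 := sub_ne_zero.2 hne
      simp only [smul_eq_mul] at hfz hFz hGz
      have hfz' : xiRot z ≠ 0 := by
        rw [hfz]; exact mul_ne_zero (pow_ne_zero _ hw) hf₁z
      -- (a) quotient rule for u at z
      have hf_an : AnalyticAt ℂ xiRot z := hfa z hzU
      have hdf : HasDerivAt xiRot (deriv xiRot z) z := hf_an.differentiableAt.hasDerivAt
      have hddf : HasDerivAt (deriv xiRot) (deriv (deriv xiRot) z) z :=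
        hf_an.deriv.differentiableAt.hasDerivAt
      have hu1 : HasDerivAt u
          ((deriv (deriv xiRot) z * xiRot z - deriv xiRot z * deriv xiRot z) / xiRot z ^ 2) z :=
        hddf.div hdf hfz'
      -- (b) local form of u near z and its derivative
      have hu_ev : u =ᶠ[𝓝 z] fun w => ((m' + 1 : ℕ) : ℂ) / (w - z₀) + deriv f₁ w / f₁ w := by
        have hne_ev : ∀ᶠ w in 𝓝 z, w ≠ z₀ := isOpen_ne.mem_nhds hne
        filter_upwards [hne_ev, hfz2, hdfz2, hf₁ne2z] with w hwne hfw hdfw hf₁w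
        have hw' : w - z₀ ≠ 0 := sub_ne_zero.2 hwne
        simp only [smul_eq_mul] at hfw
        simp only [hu, hfw, hdfw, Nat.add_sub_cancel]
        field_simp
        ring
      have hq_z : AnalyticAt ℂ (fun w => deriv f₁ w / f₁ w) z := hf₁an.deriv.div hf₁an hf₁z
      have hinv : HasDerivAt (fun w : ℂ => ((m' + 1 : ℕ) : ℂ) / (w - z₀))
          (-((m' + 1 : ℕ) : ℂ) / (z - z₀) ^ 2) z :=
        ((hasDerivAt_const z (((m' + 1 : ℕ) : ℂ))).div ((hasDerivAt_id' z).sub_const z₀) hw).congr_deriv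
          (by ring)
      have hu2 : HasDerivAt u (-((m' + 1 : ℕ) : ℂ) / (z - z₀) ^ 2 + v z) z := by
        have h := hinv.add hq_z.differentiableAt.hasDerivAt
        exact (h.congr_of_eventuallyEq hu_ev)
      have hueq := hu1.unique hu2
      -- (c) the identity P z = Q z with f² cancelled
      have hPQz := hPQ hzU
      simp only [hP, hQdef] at hPQz
      -- f'' f - f'² = (u') f²
      have hW : deriv (deriv xiRot) z * xiRot z - deriv xiRot z ^ 2 =
          (-((m' + 1 : ℕ) : ℂ) / (z - z₀) ^ 2 + v z) * xiRot z ^ 2 := by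
        rw [← hueq]; field_simp
      rw [hW] at hPQz
      have hstar : deriv G z * F z - G z * deriv F z =
          c * (-((m' + 1 : ℕ) : ℂ) / (z - z₀) ^ 2 + v z) * G z * F z := by
        have h2 : xiRot z ^ 2 ≠ 0 := pow_ne_zero 2 hfz'
        apply mul_right_cancel₀ h2
        rw [hPQz]; ring
      -- substitute the factorisations, multiply by (z - z₀)², cancel (z - z₀)^(j+k)
      rw [hdGz, hdFz, hGz, hFz] at hstar
      have hj2 := natCast_mul_pow_pred_mul_sq j (z - z₀)
      have hk2 := natCast_mul_pow_pred_mul_sq k (z - z₀)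
      have hpow : (z - z₀) ^ (j + k) ≠ 0 := pow_ne_zero _ hw
      apply mul_left_cancel₀ hpow
      calc (z - z₀) ^ (j + k) * ((z - z₀) * A z)
          = ((↑j * (z - z₀) ^ (j - 1) * G₁ z + (z - z₀) ^ j * deriv G₁ z) * ((z - z₀) ^ k * F₁ z) -
              (z - z₀) ^ j * G₁ z * (↑k * (z - z₀) ^ (k - 1) * F₁ z + (z - z₀) ^ k * deriv F₁ z)) *
              (z - z₀) ^ 2 := by
            simp only [hA]; rw [pow_add]
            linear_combination (-(z - z₀) ^ k * G₁ z * F₁ z) * hj2 + ((z - z₀) ^ j * G₁ z * F₁ z) * hk2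
        _ = (c * (-((m' + 1 : ℕ) : ℂ) / (z - z₀) ^ 2 + v z) * ((z - z₀) ^ j * G₁ z) *
              ((z - z₀) ^ k * F₁ z)) * (z - z₀) ^ 2 := by rw [hstar]
        _ = (z - z₀) ^ (j + k) * (c * B z) := by
            simp only [hB]; rw [pow_add]; field_simp
    refine eventually_nhdsWithin_iff.2 ?_
    filter_upwards [hall] with z hz hne
    exact hz hne
  -- Step 5: limits along `𝓝[≠] z₀`.
  have hA_cont : ContinuousAt A z₀ := by
    have h1 := hG₁a.continuousAt; have h2 := hF₁a.continuousAt
    have h3 := hG₁a.deriv.continuousAt; have h4 := hF₁a.deriv.continuousAt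
    simp only [hA]
    fun_prop
  have hB_cont : ContinuousAt B z₀ := by
    have h1 := hG₁a.continuousAt; have h2 := hF₁a.continuousAt
    simp only [hB]
    fun_prop
  have hlim1 : Filter.Tendsto (fun z => (z - z₀) * A z) (𝓝[≠] z₀) (𝓝 0) := by
    have h1 : Filter.Tendsto (fun z : ℂ => z - z₀) (𝓝 z₀) (𝓝 0) :=
      tendsto_sub_nhds_zero_iff.2 Filter.tendsto_id
    have h2 := (h1.mul hA_cont.tendsto)
    simp only [zero_mul] at h2
    exact h2.mono_left nhdsWithin_le_nhds
  have hlim2 : Filter.Tendsto (fun z => c * B z) (𝓝[≠] z₀) (𝓝 (c * B z₀)) :=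
    (hB_cont.tendsto.const_mul c).mono_left nhdsWithin_le_nhds
  have hEq : (0 : ℂ) = c * B z₀ := tendsto_nhds_unique (hlim1.congr' hloc) hlim2
  have hB0 : B z₀ ≠ 0 := by
    simp only [hB, sub_self, zero_pow two_ne_zero, zero_mul, add_zero]
    exact mul_ne_zero (mul_ne_zero (neg_ne_zero.2 (Nat.cast_ne_zero.2 (Nat.succ_ne_zero m'))) hG₁0) hF₁0
  exact mul_ne_zero hc0 hB0 hEq.symm


/-! ### H1_η: the quotient representation from a weighted witness -/

/-- `unitLaplace (iy) ≠ 0` for real `y > 0` (its value is `(e^{y} − 1)/y`). -/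
theorem unitLaplace_I_mul_ne_zero {y : ℝ} (hy : 0 < y) : unitLaplace ((y : ℂ) * I) ≠ 0 := by
  have hz : (y : ℂ) * I ≠ 0 := mul_ne_zero (by exact_mod_cast hy.ne') I_ne_zero
  rw [unitLaplace_eq _ hz]
  have h1 : -(I * ((y : ℂ) * I)) = (y : ℂ) := by
    rw [← mul_assoc, mul_comm I, mul_assoc, I_mul_I]; ring
  rw [h1]
  refine div_ne_zero ?_ (by exact_mod_cast hy.ne')
  rw [sub_ne_zero, ← Complex.ofReal_exp, ← Complex.ofReal_one, Ne, Complex.ofReal_inj]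
  have : (1 : ℝ) < Real.exp y := by
    have := Real.add_one_lt_exp hy.ne'; linarith
  exact this.ne'

/-- **H1_η (RH-FREE).** A weighted square-integrable window average `e^{−η·} W_θ ∈ L²` (`η ≥ 0`, `θ > 1`) gives a
holomorphic quotient representation `Θ_θ F = G` on `Im z > η + 1` with `G, F` holomorphic on `Im z > η`, `F ≢ 0`. -/
theorem quotient_of_weightedWitness {θ η : ℝ} (hθ1 : 1 < θ) (hη : 0 ≤ η)
    (hW : MemLp (fun x : ℝ => Real.exp (-η * x) * limWindowAvg θ x) 2 volume) :
    ∃ G F : ℂ → ℂ, DifferentiableOn ℂ G {z : ℂ | η < z.im} ∧ DifferentiableOn ℂ F {z : ℂ | η < z.im} ∧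
      (∃ z : ℂ, η < z.im ∧ F z ≠ 0) ∧ ∀ z : ℂ, η + 1 < z.im → limTheta θ z * F z = G z := by
  have hKc : Continuous (limKernel θ) := Suzuki2020_thm12_continuous hθ1
  have hK0 : ∀ x : ℝ, x < 0 → limKernel θ x = 0 := fun x hx => Suzuki2020_thm12_Kiii hθ1 hx
  set Wη : ℝ → ℝ := fun x => Real.exp (-η * x) * limWindowAvg θ x with hWη
  have hW0 : ∀ u : ℝ, u ≤ -1 → Wη u = 0 := fun u hu => by
    simp only [hWη, limWindowAvg, window_eq_zero_of_le hK0 hu, mul_zero]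
  have hG₀ := differentiableOn_laplace_of_memLp hW hW0
  set G : ℂ → ℂ := fun z => ∫ u : ℝ, (Wη u : ℂ) * Complex.exp (I * (z - I * η) * (u : ℂ)) with hGdef
  have hmaps : Set.MapsTo (fun z : ℂ => z - I * η) {z : ℂ | η < z.im} {z : ℂ | 0 < z.im} := by
    intro z hz
    show 0 < (z - I * η).im
    have : (z - I * η).im = z.im - η := by simp
    rw [this]; exact sub_pos.2 hz
  have hGd : DifferentiableOn ℂ G {z : ℂ | η < z.im} := by
    have h := hG₀.comp (by fun_prop : DifferentiableOn ℂ (fun z : ℂ => z - I * η) {z : ℂ | η < z.im}) hmaps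
    exact h
  refine ⟨G, unitLaplace, hGd, differentiableOn_unitLaplace.mono (fun z hz => ?_),
    ⟨((η + 1 : ℝ) : ℂ) * I, by simp, unitLaplace_I_mul_ne_zero (by linarith)⟩, fun z hz => ?_⟩
  · show 0 < z.im
    have : η < z.im := hz
    linarith
  -- the identity on Im z > η + 1
  obtain ⟨C, -, hC⟩ := abs_limKernel_le hθ1 (b := 3 / 4) (by norm_num)
  have hz34 : (3 / 4 : ℝ) < z.im := by linarith
  have h1 := laplace_window_eq hKc hK0 (by norm_num : (0 : ℝ) ≤ 3 / 4) (fun x _ => hC x) hz34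
  have h2 := (Suzuki2020_thm12_laplace hθ1 (z := z) (by linarith)).2
  have hI : I * I = -1 := I_mul_I
  have hint : ∀ u : ℝ, (Wη u : ℂ) * Complex.exp (I * (z - I * η) * (u : ℂ)) =
      ((∫ y in Set.Ioo (0 : ℝ) 1, limKernel θ (u + y) : ℝ) : ℂ) * Complex.exp (I * z * (u : ℂ)) := by
    intro u
    have he : Complex.exp (((-η * u : ℝ) : ℂ)) * Complex.exp (I * (z - I * η) * (u : ℂ)) =
        Complex.exp (I * z * (u : ℂ)) := by
      rw [← Complex.exp_add]
      congr 1
      push_cast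
      linear_combination (-(η : ℂ) * (u : ℂ)) * hI
    simp only [hWη, limWindowAvg]
    rw [Complex.ofReal_mul, Complex.ofReal_exp]
    calc Complex.exp (((-η * u : ℝ) : ℂ)) * ((∫ y in Set.Ioo (0 : ℝ) 1, limKernel θ (u + y) : ℝ) : ℂ) *
          Complex.exp (I * (z - I * η) * (u : ℂ))
        = ((∫ y in Set.Ioo (0 : ℝ) 1, limKernel θ (u + y) : ℝ) : ℂ) *
            (Complex.exp (((-η * u : ℝ) : ℂ)) * Complex.exp (I * (z - I * η) * (u : ℂ))) := by ring
      _ = ((∫ y in Set.Ioo (0 : ℝ) 1, limKernel θ (u + y) : ℝ) : ℂ) * Complex.exp (I * z * (u : ℂ)) := by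
          rw [he]
  show limTheta θ z * unitLaplace z = ∫ u : ℝ, (Wη u : ℂ) * Complex.exp (I * (z - I * η) * (u : ℂ))
  simp_rw [hint]
  rw [h1]
  congr 1
  exact h2.symm

/-- **Crux `ShiftedDoor` — PROVED (RH-FREE implication).** For `θ > 10`, `η ≥ 0`: `e^{−η·} W_θ ∈ L² ⟹ ξ ≠ 0` on
`Re s > 1/2 + η`. Verbatim the kit item's signature. Nothing here bears on the truth of RH. -/
theorem shiftedDoor : ∀ θ : ℝ, 10 < θ → ∀ η : ℝ, 0 ≤ η →
    MeasureTheory.MemLp (fun x : ℝ => Real.exp (-η * x) *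
      Summit.RiemannHypothesis.RiemannHypothesis.Theorems.SuzukiDoor.limWindowAvg θ x) 2 MeasureTheory.volume →
    ∀ s : ℂ, 1 / 2 + η < s.re → Literature.NumberTheory.LFunctions.riemannXi s ≠ 0 := by
  intro θ hθ η hη hW
  obtain ⟨G, F, hG, hF, hF0, hGF⟩ := quotient_of_weightedWitness (by linarith) hη hW
  exact xi_ne_zero_of_symbolQuotientOn (a := η + 1) (ne_of_gt (by linarith : (0 : ℝ) < θ)) (by linarith)
    (by linarith) hG hF hF0 hGF

end Summit.RiemannHypothesis.RiemannHypothesis.Theorems.SuzukiWeightedDoorDoor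

end
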